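import Literature.NumberTheory.LFunctions.FeketePolyaKernelCertificatesHigherOrder
import HarnessLib

/-!
# Fekete–Pólya certificates for large conductors: character values from quadratic-residue bitsets

Topic `Literature/NumberTheory/LFunctions`; namespace `Literature.NumberTheory.LFunctions.FeketePolyaKernel`
(sequel of `FeketePolyaKernelCertificatesHigherOrder.lean`). Small computable definitions and THEOREMS (no named
fact, no `sorry`): a Jacobi-free VALUE SUPPLY for the certificates `fpRun v q w k`. Measured on the farm, the
binary Jacobi algorithm of `FeketePolyaKernelCertificates.lean` costs `2–3 ms` of kernel time per value at
`q ≈ 10⁴` — nine tenths of an order-`4` certificate. Here the values of `(·/q)` are read off ONE numeral per prime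
factor `p` of `q`: the bitset `sqBits p (p − 1) = ⋁_{1 ≤ x < p} 2^{x² mod p}` of the non-zero squares mod `p`
(built once, `p` squarings), through Euler's criterion in the form of Mathlib's `legendreSym.eq_one_iff` /
`eq_neg_one_iff` (`legVal_eq`: `0 / +1 / −1` according as `p ∣ n` / `n` is / is not a square mod `p`), and the
Jacobi symbol of a squarefree odd `q = p₁ ⋯ p_t` is the product over a supplied factor list (`jacVal`, `resTable`,
`jacVal_resTable`: `J(n | p₁ ⋯ p_t) = ∏ J(n | p_i)`, Mathlib `jacobiSym.mul_right`). The factor list is part of the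
certificate (primality by `norm_num`, the product by `decide`); a lookup costs `≈ 25` kernel reductions per
prime factor instead of `≈ 10³`.

* `valOddR`, `valFourR`, `valEightAR`, `valEightBR` — the values of the primitive quadratic characters of
  conductor `q` (odd), `4m`, `8m` from a residue table, `= valOdd / valFour / valEightA / valEightB`
  (`valOddR_eq`, …);
* the per-conductor wrappers (parity test or certificate, statement shape of the range-file bullets) are in the
  sequel `FeketePolyaKernelCertificatesResidueWrappers.lean`.

## References

* H. L. Montgomery, R. C. Vaughan, *Multiplicative Number Theory I*, CUP 2007, §9.3 (Legendre and Jacobi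
  symbols, Euler's criterion, Thm 9.13), §11.2.1 Exercises 7–8. [MontgomeryVaughan2007]
* M. Fekete, G. Pólya, *Über ein Problem von Laguerre*, Rend. Circ. Mat. Palermo 34 (1912) 89–120. [FeketePolya1912]
-/

namespace Literature.NumberTheory.LFunctions

namespace FeketePolyaKernel

open Literature.Barriers.RiemannHypothesis PrimitiveQuadratic FeketePolyaTable SmallModuli OddSmallModuliII
open scoped NumberTheorySymbols

/-! ### The bitset of non-zero squares modulo `p` -/

/-- `sqBits p X = ⋁_{1 ≤ x ≤ X} 2^{x² mod p}` (one numeral; bit `r` set iff `r` is `x² mod p` for some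
`1 ≤ x ≤ X`). [cite: MontgomeryVaughan2007, §9.3] -/
def sqBits (p : ℕ) : ℕ → ℕ
  | 0 => 0
  | x + 1 => sqBits p x ||| (1 <<< ((x + 1) * (x + 1) % p))

/-- Bit `r` of `sqBits p X` is set iff `r = x² mod p` for some `1 ≤ x ≤ X`. [folklore] -/
private theorem testBit_sqBits (p r : ℕ) : ∀ X : ℕ,
    (sqBits p X).testBit r = true ↔ ∃ x, 1 ≤ x ∧ x ≤ X ∧ x * x % p = r
  | 0 => by simp [sqBits]
  | X + 1 => by
    rw [sqBits, Nat.testBit_lor, Bool.or_eq_true, testBit_sqBits p r X, Nat.one_shiftLeft, Nat.testBit_two_pow,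
      decide_eq_true_iff]
    constructor
    · rintro (⟨x, h1, h2, h3⟩ | h)
      · exact ⟨x, h1, by omega, h3⟩
      · exact ⟨X + 1, by omega, le_rfl, h⟩
    · rintro ⟨x, h1, h2, h3⟩
      rcases Nat.lt_succ_iff_lt_or_eq.mp (Nat.lt_succ_of_le h2) with hx | rfl
      · exact Or.inl ⟨x, h1, by omega, h3⟩
      · exact Or.inr h3

/-- **Legendre values from the bitset**: `legVal p B n = 0` if `p ∣ n`, `+1` if bit `n mod p` of `B` is set,
`−1` otherwise (`Nat.beq` / `Nat.testBit`: a few kernel reductions). [cite: MontgomeryVaughan2007, §9.3] -/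
def legVal (p B n : ℕ) : ℤ :=
  bif Nat.beq (n % p) 0 then 0 else bif B.testBit (n % p) then 1 else -1

/-- **Euler's criterion, bitset form**: for an odd prime `p`, `legVal p (sqBits p (p − 1)) n = J(n | p)`.
[cite: MontgomeryVaughan2007, §9.3] -/
theorem legVal_eq {p : ℕ} (hp : p.Prime) (n : ℕ) : legVal p (sqBits p (p - 1)) n = J((n : ℤ) | p) := by
  haveI := Fact.mk hp
  have hp0 : 0 < p := hp.pos
  rw [← jacobiSym.legendreSym.to_jacobiSym, legVal]
  have hcast : ((n : ℤ) : ZMod p) = (n : ZMod p) := Int.cast_natCast n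
  by_cases h0 : n % p = 0
  · have hz : ((n : ℤ) : ZMod p) = 0 := by
      rw [hcast, ZMod.natCast_eq_zero_iff]; exact Nat.dvd_of_mod_eq_zero h0
    rw [(legendreSym.eq_zero_iff p (n : ℤ)).mpr hz, h0]; rfl
  · have hne : ((n : ℤ) : ZMod p) ≠ 0 := by
      rw [hcast, Ne, ZMod.natCast_eq_zero_iff]; exact fun h ↦ h0 (Nat.mod_eq_zero_of_dvd h)
    have hbeq : Nat.beq (n % p) 0 = false := by
      cases h : Nat.beq (n % p) 0
      · rfl
      · exact absurd (Nat.eq_of_beq_eq_true h) h0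
    rw [hbeq, cond_false]
    -- bit `n mod p` is set iff `n` is a non-zero square mod `p`
    have hsq : (sqBits p (p - 1)).testBit (n % p) = true ↔ IsSquare ((n : ℤ) : ZMod p) := by
      rw [testBit_sqBits, hcast]
      constructor
      · rintro ⟨x, -, -, hx⟩
        refine ⟨(x : ZMod p), ?_⟩
        have : ((x * x : ℕ) : ZMod p) = (n : ZMod p) := by
          rw [ZMod.natCast_eq_natCast_iff', hx]
        rw [← this]; push_cast; rfl
      · rintro ⟨y, hy⟩
        refine ⟨y.val, ?_, ?_, ?_⟩
        · rcases Nat.eq_zero_or_pos y.val with hv | hv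
          · exfalso; apply hne
            rw [hcast, hy, show y = 0 from (ZMod.val_eq_zero y).mp hv, mul_zero]
          · exact hv
        · have := ZMod.val_lt y; omega
        · have : ((y.val * y.val : ℕ) : ZMod p) = (n : ZMod p) := by
            push_cast; rw [ZMod.natCast_zmod_val, ← hy]
          rw [(ZMod.natCast_eq_natCast_iff' _ _ _).mp this]
    by_cases hs : IsSquare ((n : ℤ) : ZMod p)
    · rw [(legendreSym.eq_one_iff p hne).mpr hs, hsq.mpr hs]; rfl
    · rw [(legendreSym.eq_neg_one_iff p).mpr hs]
      have : (sqBits p (p - 1)).testBit (n % p) = false := by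
        cases h : (sqBits p (p - 1)).testBit (n % p)
        · rfl
        · exact absurd (hsq.mp h) hs
      rw [this]; rfl

/-! ### Jacobi values from a factor list -/

/-- `jacVal [(p₁, B₁), …] n = ∏ legVal p_i B_i n`. [cite: MontgomeryVaughan2007, §9.3] -/
def jacVal : List (ℕ × ℕ) → ℕ → ℤ
  | [], _ => 1
  | (p, B) :: rest, n => legVal p B n * jacVal rest n

/-- **The residue table of a factor list**: `resTable [p₁, …] = [(p₁, sqBits p₁ (p₁ − 1)), …]` (evaluated
once by the kernel). [cite: MontgomeryVaughan2007, §9.3] -/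
def resTable (ps : List ℕ) : List (ℕ × ℕ) := ps.map fun p ↦ (p, sqBits p (p - 1))

/-- **`jacVal (resTable ps) n = J(n | ∏ ps)`** for a list of primes. [cite: MontgomeryVaughan2007, §9.3] -/
theorem jacVal_resTable : ∀ (ps : List ℕ), (∀ p ∈ ps, p.Prime) → ∀ n : ℕ,
    jacVal (resTable ps) n = J((n : ℤ) | ps.prod)
  | [], _, n => by simp [resTable, jacVal]
  | p :: rest, hps, n => by
    have hp : p.Prime := hps p (by simp)
    have hrest : ∀ p' ∈ rest, p'.Prime := fun p' hp' ↦ hps p' (by simp [hp'])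
    haveI : NeZero p := ⟨hp.ne_zero⟩
    haveI : NeZero rest.prod := ⟨List.prod_ne_zero fun h ↦ (hrest 0 h).ne_zero rfl⟩
    rw [List.prod_cons, jacobiSym.mul_right, resTable, List.map_cons, jacVal, legVal_eq hp,
      ← jacVal_resTable rest hrest n]
    rfl

/-- A product of odd numbers is odd. [folklore] -/
private theorem prod_mod_two : ∀ (ps : List ℕ), (∀ p ∈ ps, p % 2 = 1) → ps.prod % 2 = 1
  | [], _ => rfl
  | p :: rest, h => by
    rw [List.prod_cons, Nat.mul_mod, h p (by simp), prod_mod_two rest fun p' hp' ↦ h p' (by simp [hp'])]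

/-! ### The character values from residue tables -/

/-- Odd conductor: `valOddR tbl n = jacVal tbl n`. [cite: MontgomeryVaughan2007, §9.3 Theorem 9.13] -/
def valOddR (tbl : List (ℕ × ℕ)) (n : ℕ) : ℤ := jacVal tbl n

/-- Conductor `4m`: `χ₋₄(n)·jacVal tbl n`. [cite: MontgomeryVaughan2007, §9.3 Theorem 9.13] -/
def valFourR (tbl : List (ℕ × ℕ)) (n : ℕ) : ℤ := tableVal [0, 1, 0, -1] n * jacVal tbl n

/-- Conductor `8m`, first pattern: `χ₋₈(n)·jacVal tbl n`. [cite: MontgomeryVaughan2007, §9.3 Theorem 9.13] -/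
def valEightAR (tbl : List (ℕ × ℕ)) (n : ℕ) : ℤ := tableVal [0, 1, 0, 1, 0, -1, 0, -1] n * jacVal tbl n

/-- Conductor `8m`, second pattern: `χ₈(n)·jacVal tbl n`. [cite: MontgomeryVaughan2007, §9.3 Theorem 9.13] -/
def valEightBR (tbl : List (ℕ × ℕ)) (n : ℕ) : ℤ := tableVal [0, 1, 0, -1, 0, -1, 0, 1] n * jacVal tbl n

/-- The hypotheses on a factor list: all entries odd primes. [folklore] -/
private theorem facts_of_forall {ps : List ℕ} (hps : ps.Forall fun p ↦ p.Prime ∧ p ≠ 2) :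
    (∀ p ∈ ps, p.Prime) ∧ (∀ p ∈ ps, p % 2 = 1) := by
  rw [List.forall_iff_forall_mem] at hps
  exact ⟨fun p hp ↦ (hps p hp).1, fun p hp ↦ (hps p hp).1.eq_two_or_odd.resolve_left (hps p hp).2⟩

/-- **`valOddR (resTable ps) = valOdd q`** for a list `ps` of odd primes with product `q > 1`.
[cite: MontgomeryVaughan2007, §9.3 Theorem 9.13] -/
theorem valOddR_eq {ps : List ℕ} {q : ℕ} (hps : ps.Forall fun p ↦ p.Prime ∧ p ≠ 2) (hprod : ps.prod = q)
    (hq : 1 < q) (n : ℕ) : valOddR (resTable ps) n = valOdd q n := by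
  obtain ⟨hpr, hodd⟩ := facts_of_forall hps
  have hq2 : q % 2 = 1 := hprod ▸ prod_mod_two ps hodd
  rw [valOddR, jacVal_resTable ps hpr, hprod, valOdd, ← jacobiSym_eq_jac_mod hq2 hq]

/-- `valFourR (resTable ps) = valFour m` (`ps` odd primes, product `m > 1`). [cite: MontgomeryVaughan2007, §9.3 Theorem 9.13] -/
theorem valFourR_eq {ps : List ℕ} {m : ℕ} (hps : ps.Forall fun p ↦ p.Prime ∧ p ≠ 2) (hprod : ps.prod = m)
    (hm : 1 < m) (n : ℕ) : valFourR (resTable ps) n = valFour m n := by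
  obtain ⟨hpr, hodd⟩ := facts_of_forall hps
  have hm2 : m % 2 = 1 := hprod ▸ prod_mod_two ps hodd
  rw [valFourR, jacVal_resTable ps hpr, hprod, valFour, ← jacobiSym_eq_jac_mod hm2 hm]

/-- `valEightAR (resTable ps) = valEightA m`. [cite: MontgomeryVaughan2007, §9.3 Theorem 9.13] -/
theorem valEightAR_eq {ps : List ℕ} {m : ℕ} (hps : ps.Forall fun p ↦ p.Prime ∧ p ≠ 2) (hprod : ps.prod = m)
    (hm : 1 < m) (n : ℕ) : valEightAR (resTable ps) n = valEightA m n := by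
  obtain ⟨hpr, hodd⟩ := facts_of_forall hps
  have hm2 : m % 2 = 1 := hprod ▸ prod_mod_two ps hodd
  rw [valEightAR, jacVal_resTable ps hpr, hprod, valEightA, ← jacobiSym_eq_jac_mod hm2 hm]

/-- `valEightBR (resTable ps) = valEightB m`. [cite: MontgomeryVaughan2007, §9.3 Theorem 9.13] -/
theorem valEightBR_eq {ps : List ℕ} {m : ℕ} (hps : ps.Forall fun p ↦ p.Prime ∧ p ≠ 2) (hprod : ps.prod = m)
    (hm : 1 < m) (n : ℕ) : valEightBR (resTable ps) n = valEightB m n := by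
  obtain ⟨hpr, hodd⟩ := facts_of_forall hps
  have hm2 : m % 2 = 1 := hprod ▸ prod_mod_two ps hodd
  rw [valEightBR, jacVal_resTable ps hpr, hprod, valEightB, ← jacobiSym_eq_jac_mod hm2 hm]

/-- Sanity checks (kernel `decide`): `(·/53)` and `(·/1155)` from residue tables agree with the Jacobi
algorithm over a period, and `d = 53` passes at order `3`. [folklore] -/
example : (List.range 53).all (fun n ↦ valOddR (resTable [53]) n == valOdd 53 n) = true ∧
    (List.range 1155).all (fun n ↦ valOddR (resTable [3, 5, 7, 11]) n == valOdd 1155 n) = true ∧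
    fpRun (valOddR (resTable [53])) 53 1 3 = true := by
  decide +kernel


end FeketePolyaKernel

end Literature.NumberTheory.LFunctions
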